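import Mathlib
import Literature.Computability.MetaComplexity.SmolenskyDimensionBound

/-!
# Reed–Muller duality ⇒ the shortened/punctured dimension identity

Helper for line Sketch/LAR of crux stmt-QuantumAdvantage-1392 (wave 3: duality of annihilator
ranks `annRank_k(Y) ↔ annRank_{n−k−1}(Yᶜ)`). From `RM(k,n)^⊥ = RM(k',n)` (`k + k' + 1 = n`;
both inclusions — orthogonality of `RM(k)` and `RM(k')` for the dot product on the cube
`{0,1}ⁿ`, and `RM(k)^⊥ ⊆ RM(k')` — are taken as hypotheses, supplied by the neighbouring stubs
at composition time) we derive the shortened/punctured dimension identity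

  `dim {f ∈ RM(k) : f|_Y = 0} + dim RM(k') + |Y| = 2ⁿ + dim {g ∈ RM(k') : g|_{Yᶜ} = 0}`

for every set `Y` of points of the cube (MacWilliams–Sloane, *The Theory of Error-Correcting
Codes*, Ch. 1 §9, shortening/puncturing a code and its dual; standard linear algebra). Here
`{h : h|_Y = 0}` is rendered definition-free as the kernel of the restriction map
`LinearMap.funLeft _ _ (Subtype.val : {b // b ∈ Y} → _)`, and `{h : h|_{Yᶜ} = 0}` likewise with
`{b // b ∉ Y}`.

Proof: for the restriction `r : RM(k) → F^Y` one has `ker r = {f ∈ RM(k) : f|_Y = 0}`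
(rank–nullity); the orthogonal of `range r` inside `F^Y` (dot product) is the injective image
of `{g ∈ RM(k') : g|_{Yᶜ} = 0}` under restriction to `Y` (orthogonality one way, extension by
zero and duality the other way); and `dim W + dim W^⊥ = dim` of the ambient space for the
nondegenerate dot product (Mathlib's `LinearMap.BilinForm.finrank_add_finrank_orthogonal'` for
`dotProductBilin`), used once in `F^Y` and once in `F^{{0,1}ⁿ}` (where it gives
`dim RM(k) + dim RM(k') = 2ⁿ`).
-/

namespace Summit.QuantumAdvantage.DigitPolyUniformity.SketchLAR

open Finset Module
open Literature.Computability.MetaComplexity.Smolensky (CubeFn mono lowDeg)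

namespace AnnRankDualityCore

/-- **Dimension of an orthogonal complement for the dot product**: for a subspace `W ≤ F^X`
(`X` finite) and `W' = {v | ∀ w ∈ W, Σ_x w x · v x = 0}` its orthogonal for the (nondegenerate)
dot product, `dim W + dim W' = |X|`. [folklore] -/
theorem finrank_add_finrank_eq_card {F : Type*} [Field F] {X : Type*} [Fintype X]
    (W W' : Submodule F (X → F)) (hW' : ∀ v, v ∈ W' ↔ ∀ w ∈ W, ∑ x, w x * v x = 0) :
    Module.finrank F ↥W + Module.finrank F ↥W' = Fintype.card X := by
  let B : LinearMap.BilinForm F (X → F) := dotProductBilin F F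
  have hW'eq : W' = B.orthogonal W := by
    ext v
    rw [hW', LinearMap.BilinForm.mem_orthogonal_iff]
    rfl
  have hker : LinearMap.ker B = ⊥ := by
    refine (Submodule.eq_bot_iff _).2 fun v hv => ?_
    refine dotProduct_eq_zero_iff.1 fun w => ?_
    have h := LinearMap.congr_fun (LinearMap.mem_ker.1 hv) w
    exact h
  have h := LinearMap.BilinForm.finrank_add_finrank_orthogonal' (B := B) W
  rw [hker, inf_bot_eq, finrank_bot, add_zero, Module.finrank_fintype_fun_eq_card, ← hW'eq] at h
  exact h

/-- Rank–nullity for a linear map `r` restricted to a subspace `C`: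
`dim r(C) + dim (C ⊓ ker r) = dim C`. [folklore] -/
theorem finrank_range_add_finrank_inf_ker {F : Type*} [Field F] {V T : Type*} [AddCommGroup V]
    [Module F V] [FiniteDimensional F V] [AddCommGroup T] [Module F T] (C : Submodule F V)
    (r : V →ₗ[F] T) :
    Module.finrank F ↥(LinearMap.range (r.comp C.subtype)) +
      Module.finrank F ↥(C ⊓ LinearMap.ker r) = Module.finrank F ↥C := by
  rw [← Submodule.map_comap_subtype C (LinearMap.ker r), Submodule.finrank_map_subtype_eq,
    ← LinearMap.ker_comp]
  exact LinearMap.finrank_range_add_finrank_ker _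

variable {F : Type*} [Field F] {n : ℕ}

/-- The kernel of the restriction map to the points of the cube satisfying `p` consists of the
functions vanishing at those points. [folklore] -/
theorem mem_ker_funLeft_iff {p : (Fin n → Bool) → Prop} {h : CubeFn F n} :
    h ∈ LinearMap.ker (LinearMap.funLeft F F (Subtype.val : {b // p b} → (Fin n → Bool))) ↔
      ∀ b, p b → h b = 0 := by
  rw [LinearMap.mem_ker, funext_iff]
  exact ⟨fun H b hb => H ⟨b, hb⟩, fun H y => H y.1 y.2⟩

/-- **Orthogonality survives restriction to `Y` for functions supported in `Y`**: if `f ∈ C`,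
`g ∈ C'` with `C ⊥ C'`, and `g` vanishes off `Y`, then `Σ_{y ∈ Y} f y · g y = Σ_b f b · g b = 0`.
[folklore] -/
theorem sum_restrict_eq_zero {C C' : Submodule F (CubeFn F n)}
    (hOrth : ∀ f g : CubeFn F n, f ∈ C → g ∈ C' → ∑ b : Fin n → Bool, f b * g b = 0)
    (Y : Finset (Fin n → Bool)) {f g : CubeFn F n} (hf : f ∈ C) (hg : g ∈ C')
    (hg0 : ∀ b, b ∉ Y → g b = 0) :
    ∑ y : {b // b ∈ Y}, f y.1 * g y.1 = 0 :=
  calc ∑ y : {b // b ∈ Y}, f y.1 * g y.1 = ∑ b ∈ Y, f b * g b :=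
        (Finset.sum_subtype Y (fun _ => Iff.rfl) (fun b => f b * g b)).symm
    _ = ∑ b, f b * g b :=
        Finset.sum_subset (Finset.subset_univ Y) fun b _ hb => by rw [hg0 b hb, mul_zero]
    _ = 0 := hOrth f g hf hg

/-- **Extension by zero**: a vector `v ∈ F^Y` orthogonal to all restrictions `f|_Y` (`f ∈ C`)
extends by zero to a function `u ∈ C^⊥ ⊆ C'` vanishing off `Y` with `u|_Y = v`. [folklore] -/
theorem exists_extend {C C' : Submodule F (CubeFn F n)}
    (hDual : ∀ u : CubeFn F n,
      (∀ f : CubeFn F n, f ∈ C → ∑ b : Fin n → Bool, u b * f b = 0) → u ∈ C')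
    (Y : Finset (Fin n → Bool)) (v : {b // b ∈ Y} → F)
    (hv : ∀ f ∈ C, ∑ y : {b // b ∈ Y}, f y.1 * v y = 0) :
    ∃ u ∈ C', (∀ b, b ∉ Y → u b = 0) ∧ ∀ y : {b // b ∈ Y}, u y.1 = v y := by
  refine ⟨fun b => if hb : b ∈ Y then v ⟨b, hb⟩ else 0, ?_, fun b hb => dif_neg hb, fun y => ?_⟩
  · refine hDual _ fun f hf => ?_
    calc ∑ b, (if hb : b ∈ Y then v ⟨b, hb⟩ else 0) * f b
          = ∑ b ∈ Y, (if hb : b ∈ Y then v ⟨b, hb⟩ else 0) * f b :=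
          (Finset.sum_subset (Finset.subset_univ Y) fun b _ hb => by rw [dif_neg hb, zero_mul]).symm
      _ = ∑ y : {b // b ∈ Y}, (if hb : (y.1 : Fin n → Bool) ∈ Y then v ⟨y.1, hb⟩ else 0) * f y.1 :=
          Finset.sum_subtype Y (fun _ => Iff.rfl)
            (fun b => (if hb : b ∈ Y then v ⟨b, hb⟩ else 0) * f b)
      _ = ∑ y : {b // b ∈ Y}, f y.1 * v y :=
          Finset.sum_congr rfl fun y _ => by rw [dif_pos y.2, mul_comm]
      _ = 0 := hv f hf
  · exact dif_pos y.2

/-- **The shortened/punctured dimension identity from duality** (abstract form): `C, C'` are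
subspaces of `F^{{0,1}ⁿ}` with `C ⊥ C'` (`hOrth`) and `C^⊥ ⊆ C'` (`hDual`) for the dot product,
`ρ` is the restriction map to a finite set `Y` of points and `K` the space of functions vanishing
off `Y`; then `dim (C ⊓ ker ρ) + dim C' + |Y| = 2ⁿ + dim (C' ⊓ K)`. Proof: rank–nullity for
`ρ|_C`; `ρ(C' ⊓ K) = ρ(C)^⊥` in `F^Y` with `ρ` injective on `C' ⊓ K`; and
`dim W + dim W^⊥ = dim` (ambient) twice. [folklore] -/
theorem finrank_identity_aux (C C' : Submodule F (CubeFn F n))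
    (hOrth : ∀ f g : CubeFn F n, f ∈ C → g ∈ C' → ∑ b : Fin n → Bool, f b * g b = 0)
    (hDual : ∀ u : CubeFn F n,
      (∀ f : CubeFn F n, f ∈ C → ∑ b : Fin n → Bool, u b * f b = 0) → u ∈ C')
    (Y : Finset (Fin n → Bool)) (ρ : CubeFn F n →ₗ[F] ({b // b ∈ Y} → F))
    (hρ : ∀ (f : CubeFn F n) (y : {b // b ∈ Y}), ρ f y = f y.1)
    (K : Submodule F (CubeFn F n)) (hK : ∀ g : CubeFn F n, g ∈ K ↔ ∀ b, b ∉ Y → g b = 0) :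
    Module.finrank F ↥(C ⊓ LinearMap.ker ρ) + Module.finrank F ↥C' + Y.card =
      2 ^ n + Module.finrank F ↥(C' ⊓ K) := by
  -- membership in `A' = C' ⊓ K`
  have hA' : ∀ g : CubeFn F n, g ∈ C' ⊓ K ↔ g ∈ C' ∧ ∀ b, b ∉ Y → g b = 0 := fun g => by
    rw [Submodule.mem_inf, hK]
  -- (1) rank–nullity for `ρ|_C`
  have h1 : Module.finrank F ↥(LinearMap.range (ρ.comp C.subtype)) +
      Module.finrank F ↥(C ⊓ LinearMap.ker ρ) = Module.finrank F ↥C :=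
    finrank_range_add_finrank_inf_ker C ρ
  -- (2) `ρ` is injective on `A'` (an element of `A'` killed by `ρ` vanishes on and off `Y`)
  have h2 : Module.finrank F ↥(LinearMap.range (ρ.comp (C' ⊓ K).subtype)) =
      Module.finrank F ↥(C' ⊓ K) := by
    refine LinearMap.finrank_range_of_inj ((injective_iff_map_eq_zero _).2 fun g hg => ?_)
    obtain ⟨-, hg0⟩ := (hA' g).1 g.2
    refine Subtype.ext (funext fun b => ?_)
    by_cases hb : b ∈ Y
    · have h := congrFun hg ⟨b, hb⟩
      rw [LinearMap.comp_apply, Submodule.subtype_apply, hρ] at h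
      exact h
    · exact hg0 b hb
  -- (3) `ρ(A') = ρ(C)^⊥` inside `F^Y`, so the dimensions add up to `|Y|`
  have h3 : Module.finrank F ↥(LinearMap.range (ρ.comp C.subtype)) +
      Module.finrank F ↥(LinearMap.range (ρ.comp (C' ⊓ K).subtype)) = Y.card := by
    have h := finrank_add_finrank_eq_card (LinearMap.range (ρ.comp C.subtype))
      (LinearMap.range (ρ.comp (C' ⊓ K).subtype)) fun v => by
        constructor
        · rintro ⟨g, rfl⟩ _ ⟨f, rfl⟩
          obtain ⟨hgC', hg0⟩ := (hA' g).1 g.2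
          simp only [LinearMap.comp_apply, Submodule.subtype_apply, hρ]
          exact sum_restrict_eq_zero hOrth Y f.2 hgC' hg0
        · intro hv
          obtain ⟨u, huC', hu0, huv⟩ := exists_extend hDual Y v fun f hf => by
            have h := hv (ρ f) ⟨⟨f, hf⟩, rfl⟩
            simpa only [hρ] using h
          refine ⟨⟨u, (hA' u).2 ⟨huC', hu0⟩⟩, funext fun y => ?_⟩
          rw [LinearMap.comp_apply, Submodule.subtype_apply, hρ]
          exact huv y
    rw [Fintype.card_coe] at h
    exact h
  -- (4) `dim C + dim C' = 2ⁿ` (`C' = C^⊥` in `F^{{0,1}ⁿ}`)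
  have h4 : Module.finrank F ↥C + Module.finrank F ↥C' = 2 ^ n := by
    have h := finrank_add_finrank_eq_card C C' fun v =>
      ⟨fun hv w hw => hOrth w v hw hv, fun hv => hDual v fun f hf => by
        rw [← hv f hf]
        exact Finset.sum_congr rfl fun b _ => mul_comm _ _⟩
    have hcard : Fintype.card (Fin n → Bool) = 2 ^ n := by simp
    rw [hcard] at h
    exact h
  omega

end AnnRankDualityCore

/-- **Reed–Muller duality ⇒ the shortened/punctured dimension identity.** Over `GF(2)`, assume
`RM(k,n) ⊥ RM(k',n)` for the dot product on the cube (`hOrth`) and `RM(k,n)^⊥ ⊆ RM(k',n)`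
(`hDual`), where `k + k' + 1 = n` (`RM(k,n) = lowDeg (ZMod 2) n k`). Then for every set `Y` of
points of the cube,
`dim {f ∈ RM(k) : f|_Y = 0} + dim RM(k') + |Y| = 2ⁿ + dim {g ∈ RM(k') : g|_{Yᶜ} = 0}`,
the vanishing conditions being the kernels of the restriction maps `LinearMap.funLeft` along
`{b // b ∈ Y} ↪ cube` and `{b // b ∉ Y} ↪ cube`. (MacWilliams–Sloane, Ch. 1 §9.) [folklore] -/
theorem stub_annRank_duality_core {n k k' : ℕ} (hkk' : k + k' + 1 = n)
    (hOrth : ∀ f g : CubeFn (ZMod 2) n, f ∈ lowDeg (ZMod 2) n k → g ∈ lowDeg (ZMod 2) n k' →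
      ∑ b : Fin n → Bool, f b * g b = 0)
    (hDual : ∀ u : CubeFn (ZMod 2) n,
      (∀ f : CubeFn (ZMod 2) n, f ∈ lowDeg (ZMod 2) n k → ∑ b : Fin n → Bool, u b * f b = 0) →
        u ∈ lowDeg (ZMod 2) n k')
    (Y : Finset (Fin n → Bool)) :
    Module.finrank (ZMod 2) ↥(lowDeg (ZMod 2) n k ⊓
        LinearMap.ker (LinearMap.funLeft (ZMod 2) (ZMod 2) (Subtype.val : {b // b ∈ Y} → (Fin n → Bool)))) +
      Module.finrank (ZMod 2) ↥(lowDeg (ZMod 2) n k') + Y.card =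
    2 ^ n + Module.finrank (ZMod 2) ↥(lowDeg (ZMod 2) n k' ⊓
        LinearMap.ker (LinearMap.funLeft (ZMod 2) (ZMod 2) (Subtype.val : {b // b ∉ Y} → (Fin n → Bool)))) := by
  subst hkk'
  exact AnnRankDualityCore.finrank_identity_aux (lowDeg (ZMod 2) _ k) (lowDeg (ZMod 2) _ k')
    hOrth hDual Y (LinearMap.funLeft (ZMod 2) (ZMod 2) (Subtype.val : {b // b ∈ Y} → _))
    (fun _ _ => rfl) _ fun _ => AnnRankDualityCore.mem_ker_funLeft_iff

end Summit.QuantumAdvantage.DigitPolyUniformity.SketchLAR
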